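import Mathlib
import Summits.NavierStokesRegularity.NavierStokesRegularity.Theorems.RecurrentProfilesRecurrentLiouvilleClockAdjointMassTools
import HarnessLib

/-!
# Kato's `L¹` mass inequality for adjoint test fields
(crux stmt-NavierStokesRegularity-1589 `RecurrentProfiles.RecurrentLiouville`, line `Sketch`
(ideator-4 `flux-weighted-stretching-clock`), registered stub `stub_clockAdjointMass`, K1′ of the card)

On a window `S = [t₀, t₁]` let `u` be a jointly smooth divergence-free drift on `ℝ³` with `u` and
`∇u` bounded (no Navier–Stokes is needed), and let `η` be a jointly smooth, uniformly rapidly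
decaying (`HasUniformRapidDecayOn`) solution of the ADJOINT (backward parabolic) vorticity-type
equation `∂ₜη + Δη + (u·∇)η + (∇u)ᵀη = 0` on `S × ℝ³`, `(∇u)ᵀ = adjoint (fderiv ℝ (u t) x)`.
Let `Λ ≥ 0` be a bounded continuous majorant of the strain form, `⟪∇u ξ, ξ⟫ ≤ Λ ‖ξ‖²`. Then the
`L¹` mass `m(t) = ∫ ‖η(t, x)‖ dx` grows BACKWARD in time at most by the `|η|`-weighted strain:
`m(s) ≤ m(t₁) + ∫_s^{t₁} ∫ Λ ‖η‖` for every `s ∈ S` (`stub_clockAdjointMass`).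

Proof (Kato's inequality, cut-off version; the slice tools are in
`…RecurrentLiouvilleClockAdjointMassTools`). For `δ > 0`, `R ≥ 1` the regularised cut-off mass
`Φ(t) = ∫ (√(‖η t‖² + δ²) − δ) χ_R` is continuous on `S` and differentiable on its interior
(differentiation under the integral sign on the compact support of `χ_R`), with
`Φ′(t) = ∫ ⟪η, −(Δη + Dη u + (Du)ᵀη)⟫/ρ χ_R ≥ −((B C₁ + C₂)/R) M − ∫ Λ t ‖η t‖`
(`clockMass_slice_integral_ge`: diffusion `≥ −∫ (ρ − δ) Δχ_R` by Kato's pointwise inequality and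
Green's identity, transport `= ∫ (ρ − δ) u·∇χ_R` by `div u = 0`, stretching
`⟪(Du)ᵀη, η⟫/ρ = ⟪Du η, η⟫/ρ ≤ Λ‖η‖²/ρ ≤ Λ‖η‖`; `M` a uniform `L¹` bound from the decay). Hence
`t ↦ Φ(t) + ((B C₁ + C₂)/R) M t + ∫_{t₀}^t ∫ Λ‖η‖` is monotone on `S` (`monotoneOn_of_deriv_nonneg`,
the source `t ↦ ∫ Λ t ‖η t‖` being continuous by dominated convergence), which is the claim up to
`O(1/R)`; finally `δ = 1/(n+1)`, `R = n + 1 → ∞` by dominated convergence.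

## References

* T. Kato, Israel J. Math. 13 (1972) 135–148 (Kato's inequality).
* P. Constantin, Comm. Math. Phys. 129 (1990) 241–266, §2 (2.9). [Constantin1990]
-/

noncomputable section

-- the sub-problem namespace repeats the summit name (D-0017 layout `Summit.<S>.<P>.Theorems`)
set_option linter.dupNamespace false

namespace Summit.NavierStokesRegularity.NavierStokesRegularity.Theorems

open MeasureTheory Set Function Filter Topology TopologicalSpace Metric
open Literature.Analysis Literature.Analysis.FluidPDE
open Literature.Analysis.FluidPDE.PineauVicol2026
open scoped NNReal ENNReal RealInnerProductSpace Laplacian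

/-! ### The regularised cut-off mass functional `Φ(r) = ∫ (ρ_δ(η r) − δ) χ_R` -/

section Functional

variable {t₀ t₁ δ R : ℝ}
  {u η : ℝ → EuclideanSpace ℝ (Fin 3) → EuclideanSpace ℝ (Fin 3)}

/-- **Continuity of the regularised cut-off mass functional** on the closed block `[t₀, t₁]`
(joint continuity of `η`, uniformly compact support of the cut-off). [folklore] -/
theorem clockMass_continuousOn_cutoffIntegral (hη : IsSmoothSpaceTimeOn (Icc t₀ t₁) η)
    (hδ : 0 < δ) (hR : 0 < R) :
    ContinuousOn (fun r => ∫ x, (absApprox δ ‖η r x‖ - δ) * cutoff R x) (Icc t₀ t₁) := by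
  have h1 : ContinuousOn (fun z : ℝ × EuclideanSpace ℝ (Fin 3) =>
      (absApprox δ ‖uncurry η z‖ - δ) * cutoff R z.2) (Icc t₀ t₁ ×ˢ univ) :=
    (((contDiff_absApprox hδ (n := 0)).continuous.comp_continuousOn hη.continuousOn.norm).sub
      continuousOn_const).mul ((contDiff_cutoff (n := 0) R).continuous.comp_continuousOn
      continuousOn_snd)
  refine continuousOn_integral_of_support_subset (Φ := fun r x => (absApprox δ ‖η r x‖ - δ) *
    cutoff R x) (isCompact_closedBall (0 : EuclideanSpace ℝ (Fin 3)) (2 * R)) h1 fun r _ x hx => ?_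
  rw [mem_closedBall_zero_iff, not_le] at hx
  simp [cutoff_eq_zero hR hx.le]

/-- **First variation of the regularised cut-off mass functional.** For `η` jointly smooth on
`[t₀, t₁] × ℝ³` solving the adjoint equation `∂ₜη + Δη + (u·∇)η + (∇u)ᵀη = 0` there (one-sided
time derivative within `[t₀, t₁]`), `δ > 0`, `R > 0` and an interior time `τ ∈ (t₀, t₁)`,
`d/dτ ∫ (ρ_δ(η τ) − δ) χ_R = ∫ ⟪η τ, −(Δη τ + Dη τ (u τ) + (Du τ)ᵀ η τ)⟫/ρ_δ(η τ) χ_R`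
(differentiation under the integral sign on the compact support of `χ_R`, then the equation). [folklore] -/
theorem clockMass_hasDerivAt_cutoffIntegral (hη : IsSmoothSpaceTimeOn (Icc t₀ t₁) η)
    (hpde : ∀ t ∈ Icc t₀ t₁, ∀ x, timeDerivWithin (Icc t₀ t₁) η t x + (Δ (η t)) x +
      convect (u t) (η t) x + ContinuousLinearMap.adjoint (fderiv ℝ (u t) x) (η t x) = 0)
    (hδ : 0 < δ) (hR : 0 < R) {τ : ℝ} (hτ : τ ∈ Ioo t₀ t₁) :
    HasDerivAt (fun r => ∫ x, (absApprox δ ‖η r x‖ - δ) * cutoff R x)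
      (∫ x, ⟪η τ x, -((Δ (η τ)) x + fderiv ℝ (η τ) x (u τ x) +
          ContinuousLinearMap.adjoint (fderiv ℝ (u τ) x) (η τ x))⟫ / absApprox δ ‖η τ x‖ *
        cutoff R x) τ := by
  have hS₀ : IsOpen (Ioo t₀ t₁) := isOpen_Ioo
  have hη₀ : IsSmoothSpaceTimeOn (Ioo t₀ t₁) η := hη.mono Ioo_subset_Icc_self
  obtain ⟨Φ, hΦ⟩ : ∃ Φ : ℝ → EuclideanSpace ℝ (Fin 3) → ℝ,
      Φ = fun r x => (absApprox δ ‖η r x‖ - δ) * cutoff R x := ⟨_, rfl⟩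
  have hΦs : IsSmoothSpaceTimeOn (Ioo t₀ t₁) Φ := by
    have h1 : ContDiffOn ℝ ((⊤ : ℕ∞) : WithTop ℕ∞) (fun z : ℝ × EuclideanSpace ℝ (Fin 3) =>
        (Real.sqrt (‖uncurry η z‖ ^ 2 + δ ^ 2) - δ) * cutoff R z.2) (Ioo t₀ t₁ ×ˢ univ) :=
      ((((hη₀.norm_sq ℝ).add contDiffOn_const).sqrt fun z _ =>
        (absApprox_arg_pos hδ _).ne').sub contDiffOn_const).mul
        ((contDiff_cutoff R).comp_contDiffOn contDiffOn_snd)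
    rw [hΦ]
    exact h1
  have hsupp : ∀ r ∈ Ioo t₀ t₁, ∀ x ∉ closedBall (0 : EuclideanSpace ℝ (Fin 3)) (2 * R),
      Φ r x = 0 := by
    intro r _ x hx
    rw [mem_closedBall_zero_iff, not_le] at hx
    simp [hΦ, cutoff_eq_zero hR hx.le]
  have hA := hasDerivAt_integral_of_support_subset (μ := volume) hS₀ hΦs
    (isCompact_closedBall 0 (2 * R)) hsupp hτ
  -- the pointwise time derivative, with the equation inserted
  have hline : ∀ x, HasDerivAt (fun r => η r x) (-((Δ (η τ)) x + fderiv ℝ (η τ) x (u τ x) +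
      ContinuousLinearMap.adjoint (fderiv ℝ (u τ) x) (η τ x))) τ := by
    intro x
    have h1 := hη₀.hasDerivAt_timeLine hS₀ hτ x
    have heq := hpde τ (Ioo_subset_Icc_self hτ) x
    rw [timeDerivWithin_eq_deriv_of_mem_nhds (Icc_mem_nhds hτ.1 hτ.2), convect_apply] at heq
    have heq' : deriv (fun s => η s x) τ + ((Δ (η τ)) x + fderiv ℝ (η τ) x (u τ x) +
        ContinuousLinearMap.adjoint (fderiv ℝ (u τ) x) (η τ x)) = 0 := by
      rw [← heq]; abel
    exact h1.congr_deriv (eq_neg_of_add_eq_zero_left heq')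
  have hpt : ∀ x, deriv (fun r => Φ r x) τ = ⟪η τ x, -((Δ (η τ)) x + fderiv ℝ (η τ) x (u τ x) +
      ContinuousLinearMap.adjoint (fderiv ℝ (u τ) x) (η τ x))⟫ / absApprox δ ‖η τ x‖ *
        cutoff R x := by
    intro x
    have h2 : HasDerivAt (fun r => ‖η r x‖ ^ 2 + δ ^ 2) (2 * ⟪η τ x, -((Δ (η τ)) x +
        fderiv ℝ (η τ) x (u τ x) + ContinuousLinearMap.adjoint (fderiv ℝ (u τ) x) (η τ x))⟫) τ :=
      (hline x).norm_sq.add_const (δ ^ 2)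
    have h3 := ((h2.sqrt (absApprox_arg_pos hδ _).ne').sub_const δ).mul_const (cutoff R x)
    rw [hΦ]
    unfold absApprox
    rw [h3.deriv]
    have hpos : 0 < Real.sqrt (‖η τ x‖ ^ 2 + δ ^ 2) := absApprox_pos hδ _
    field_simp
  have hfin := hA.congr_deriv (integral_congr_ae (Eventually.of_forall hpt))
  rw [hΦ] at hfin
  exact hfin

/-- **Monotonicity up to `O(1/R)` and the stretching source.** Under the hypotheses of the stub
(drift `u ∈ C¹` divergence-free with `‖u‖ ≤ B`, adjoint field `η`, nonnegative strain majorant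
`Λ`), with `M` a uniform bound for `∫ ‖η τ‖`, `τ ∈ [t₀, t₁]`, `G(τ) = ∫ Λ τ ‖η τ‖` continuous on
`[t₀, t₁]`, and the cut-off constants `C₁`, `C₂`: for `δ > 0`, `R ≥ 1` and `s ∈ [t₀, t₁]`,
`Φ(s) ≤ Φ(t₁) + ((B C₁ + C₂)/R) M (t₁ − s) + ∫_s^{t₁} G`, `Φ(r) = ∫ (ρ_δ(η r) − δ) χ_R`
(the function `Φ(t) + ((B C₁ + C₂)/R) M t + ∫_{t₀}^t G` is continuous on `[t₀, t₁]` with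
nonnegative derivative on `(t₀, t₁)` by `clockMass_slice_integral_ge`, hence monotone). [folklore] -/
theorem clockMass_cutoffIntegral_le {C₁ C₂ M B : ℝ} {Λ : ℝ → EuclideanSpace ℝ (Fin 3) → ℝ}
    (h01 : t₀ < t₁) (hu1 : ∀ t ∈ Icc t₀ t₁, ContDiff ℝ 1 (u t))
    (hdiv : ∀ t ∈ Icc t₀ t₁, VectorCalculus.IsDivFree (u t))
    (hB : ∀ t ∈ Icc t₀ t₁, ∀ x, ‖u t x‖ ≤ B) (hη : IsSmoothSpaceTimeOn (Icc t₀ t₁) η)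
    (hpde : ∀ t ∈ Icc t₀ t₁, ∀ x, timeDerivWithin (Icc t₀ t₁) η t x + (Δ (η t)) x +
      convect (u t) (η t) x + ContinuousLinearMap.adjoint (fderiv ℝ (u t) x) (η t x) = 0)
    (hηi : ∀ t ∈ Icc t₀ t₁, Integrable (η t)) (hM : ∀ t ∈ Icc t₀ t₁, ∫ x, ‖η t x‖ ≤ M)
    (hΛ0 : ∀ t ∈ Icc t₀ t₁, ∀ x, 0 ≤ Λ t x)
    (hΛ : ∀ t ∈ Icc t₀ t₁, ∀ x ξ, ⟪fderiv ℝ (u t) x ξ, ξ⟫ ≤ Λ t x * ‖ξ‖ ^ 2)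
    (hΛi : ∀ t ∈ Icc t₀ t₁, Integrable fun x => Λ t x * ‖η t x‖)
    (hG : ContinuousOn (fun t => ∫ x, Λ t x * ‖η t x‖) (Icc t₀ t₁))
    (hδ : 0 < δ) (hR : 1 ≤ R) (hC₁0 : 0 ≤ C₁)
    (hC₁ : ∀ x, ‖fderiv ℝ (cutoff R : EuclideanSpace ℝ (Fin 3) → ℝ) x‖ ≤ C₁ / R) (hC₂0 : 0 ≤ C₂)
    (hC₂ : ∀ x, |(Δ (cutoff R : EuclideanSpace ℝ (Fin 3) → ℝ)) x| ≤ C₂ / R ^ 2) {s : ℝ}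
    (hs : s ∈ Icc t₀ t₁) :
    ∫ x, (absApprox δ ‖η s x‖ - δ) * cutoff R x ≤
      (∫ x, (absApprox δ ‖η t₁ x‖ - δ) * cutoff R x) + (B * C₁ + C₂) / R * M * (t₁ - s) +
        ∫ t in s..t₁, ∫ x, Λ t x * ‖η t x‖ := by
  have hR0 : 0 < R := one_pos.trans_le hR
  have h0 : t₀ ∈ Icc t₀ t₁ := left_mem_Icc.2 h01.le
  have h1 : t₁ ∈ Icc t₀ t₁ := right_mem_Icc.2 h01.le
  obtain ⟨Φ, hΦ⟩ : ∃ Φ : ℝ → ℝ, Φ = fun r => ∫ x, (absApprox δ ‖η r x‖ - δ) * cutoff R x :=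
    ⟨_, rfl⟩
  obtain ⟨G, hGdef⟩ : ∃ G : ℝ → ℝ, G = fun t => ∫ x, Λ t x * ‖η t x‖ := ⟨_, rfl⟩
  rw [← hGdef] at hG
  set c : ℝ := (B * C₁ + C₂) / R * M with hc
  have hcont : ContinuousOn Φ (Icc t₀ t₁) := hΦ ▸ clockMass_continuousOn_cutoffIntegral hη hδ hR0
  have hderiv : ∀ τ ∈ Ioo t₀ t₁, HasDerivAt Φ (∫ x, ⟪η τ x, -((Δ (η τ)) x +
      fderiv ℝ (η τ) x (u τ x) + ContinuousLinearMap.adjoint (fderiv ℝ (u τ) x) (η τ x))⟫ /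
        absApprox δ ‖η τ x‖ * cutoff R x) τ := fun τ hτ =>
    hΦ ▸ clockMass_hasDerivAt_cutoffIntegral hη hpde hδ hR0 hτ
  -- lower bound of `Φ'`
  have hB0 : 0 ≤ B := (norm_nonneg _).trans (hB t₀ h0 0)
  have hK0 : 0 ≤ (B * C₁ + C₂) / R := div_nonneg (add_nonneg (mul_nonneg hB0 hC₁0) hC₂0) hR0.le
  have hge : ∀ τ ∈ Ioo t₀ t₁, -c - G τ ≤ ∫ x, ⟪η τ x, -((Δ (η τ)) x +
      fderiv ℝ (η τ) x (u τ x) + ContinuousLinearMap.adjoint (fderiv ℝ (u τ) x) (η τ x))⟫ /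
        absApprox δ ‖η τ x‖ * cutoff R x := by
    intro τ hτ
    have hτ' : τ ∈ Icc t₀ t₁ := Ioo_subset_Icc_self hτ
    have hslice := clockMass_slice_integral_ge ((hη.contDiff_slice hτ').of_le (by norm_cast))
      (hηi τ hτ') (hu1 τ hτ') (hdiv τ hτ') (hB τ hτ') (hΛ0 τ hτ') (hΛ τ hτ') (hΛi τ hτ') hδ hR
      hC₁0 hC₁ hC₂0 hC₂
    refine le_trans ?_ hslice
    have h2 : (B * C₁ + C₂) / R * ∫ x, ‖η τ x‖ ≤ c := mul_le_mul_of_nonneg_left (hM τ hτ') hK0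
    have h3 : G τ = ∫ x, Λ τ x * ‖η τ x‖ := by rw [hGdef]
    linarith
  -- the primitive of `G`
  have hGint : ∀ a ∈ Icc t₀ t₁, ∀ b ∈ Icc t₀ t₁, IntervalIntegrable G volume a b :=
    fun a ha b hb => (hG.mono (uIcc_subset_Icc ha hb)).intervalIntegrable
  have hPcont : ContinuousOn (fun t => ∫ τ in t₀..t, G τ) (Icc t₀ t₁) := by
    have h2 : IntegrableOn G (uIcc t₀ t₁) volume := by
      rw [uIcc_of_le h01.le]
      exact hG.integrableOn_compact isCompact_Icc
    have := intervalIntegral.continuousOn_primitive_interval (μ := volume) h2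
    rwa [uIcc_of_le h01.le] at this
  have hPderiv : ∀ t ∈ Ioo t₀ t₁, HasDerivAt (fun t => ∫ τ in t₀..t, G τ) (G t) t := by
    intro t ht
    exact intervalIntegral.integral_hasDerivAt_right (hGint t₀ h0 t (Ioo_subset_Icc_self ht))
      (ContinuousOn.stronglyMeasurableAtFilter isOpen_Ioo (hG.mono Ioo_subset_Icc_self) t ht)
      (hG.continuousAt (Icc_mem_nhds ht.1 ht.2))
  -- the monotone function `Ψ`
  obtain ⟨Ψ, hΨ⟩ : ∃ Ψ : ℝ → ℝ, Ψ = fun t => Φ t + c * t + ∫ τ in t₀..t, G τ := ⟨_, rfl⟩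
  have hΨcont : ContinuousOn Ψ (Icc t₀ t₁) :=
    hΨ ▸ (hcont.add (continuousOn_const.mul continuousOn_id)).add hPcont
  have hΨderiv : ∀ t ∈ Ioo t₀ t₁, HasDerivAt Ψ ((∫ x, ⟪η t x, -((Δ (η t)) x +
      fderiv ℝ (η t) x (u t x) + ContinuousLinearMap.adjoint (fderiv ℝ (u t) x) (η t x))⟫ /
        absApprox δ ‖η t x‖ * cutoff R x) + c * 1 + G t) t := fun t ht =>
    hΨ ▸ ((hderiv t ht).add ((hasDerivAt_id t).const_mul c)).add (hPderiv t ht)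
  have hmono : MonotoneOn Ψ (Icc t₀ t₁) := by
    refine monotoneOn_of_deriv_nonneg (convex_Icc t₀ t₁) hΨcont ?_ ?_
    · rw [interior_Icc]
      exact fun t ht => (hΨderiv t ht).differentiableAt.differentiableWithinAt
    · rw [interior_Icc]
      intro t ht
      rw [(hΨderiv t ht).deriv]
      have := hge t ht
      linarith
  have key := hmono hs h1 hs.2
  have hsplit : (∫ τ in t₀..t₁, G τ) - ∫ τ in t₀..s, G τ = ∫ τ in s..t₁, G τ :=
    intervalIntegral.integral_interval_sub_left (hGint t₀ h0 t₁ h1) (hGint t₀ h0 s hs)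
  have eΦs : Φ s = ∫ x, (absApprox δ ‖η s x‖ - δ) * cutoff R x := by rw [hΦ]
  have eΦ1 : Φ t₁ = ∫ x, (absApprox δ ‖η t₁ x‖ - δ) * cutoff R x := by rw [hΦ]
  have eG : (∫ τ in s..t₁, G τ) = ∫ t in s..t₁, ∫ x, Λ t x * ‖η t x‖ := by rw [hGdef]
  rw [hΨ] at key
  simp only at key
  rw [← eΦs, ← eΦ1, ← eG, ← hsplit]
  nlinarith [key]

end Functional

/-! ### The registered stub -/

/-- **Kato's `L¹` mass inequality for adjoint test fields** (registered stub
`stub_clockAdjointMass`, K1′ of the card `flux-weighted-stretching-clock`).  On a window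
`S = [t₀, t₁]` let `u` be a jointly smooth divergence-free drift with `u`, `∇u` bounded, and let
`η` be a jointly smooth, uniformly rapidly decaying solution of the adjoint equation
`∂ₜη + Δη + (u·∇)η + (∇u)ᵀη = 0`; let `Λ ≥ 0` be a bounded continuous majorant of the strain
form, `⟪∇u ξ, ξ⟫ ≤ Λ‖ξ‖²`.  Then the `L¹` mass `m(t) = ∫ ‖η(t)‖` grows backward in time at
most by the weighted strain: `m(s) ≤ m(t₁) + ∫_s^{t₁} ∫ Λ‖η‖` for every `s ∈ S`.
Proof: Kato's inequality for the regularised cut-off mass `∫ (√(‖η‖² + δ²) − δ) χ_R`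
(`clockMass_cutoffIntegral_le`: diffusion `≥ −∫ (ρ−δ)Δχ_R`, transport `= ∫ (ρ−δ) u·∇χ_R`,
stretching `≥ −∫ Λ‖η‖`), then `δ = 1/(n+1)`, `R = n+1 → ∞` (dominated convergence).
[cite: Constantin1990, (2.9)] -/
theorem stub_clockAdjointMass :
    ∀ (t₀ t₁ : ℝ), t₀ < t₁ →
      ∀ (u η : ℝ → EuclideanSpace ℝ (Fin 3) → EuclideanSpace ℝ (Fin 3))
        (Λ : ℝ → EuclideanSpace ℝ (Fin 3) → ℝ),
      IsSmoothSpaceTimeOn (Set.Icc t₀ t₁) u →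
      (∀ t ∈ Set.Icc t₀ t₁, VectorCalculus.IsDivFree (u t)) →
      (∃ B : ℝ, ∀ t ∈ Set.Icc t₀ t₁, ∀ x : EuclideanSpace ℝ (Fin 3),
        ‖u t x‖ ≤ B ∧ ‖fderiv ℝ (u t) x‖ ≤ B) →
      IsSmoothSpaceTimeOn (Set.Icc t₀ t₁) η →
      HasUniformRapidDecayOn (Set.Icc t₀ t₁) η →
      (∀ t ∈ Set.Icc t₀ t₁, ∀ x : EuclideanSpace ℝ (Fin 3),
        timeDerivWithin (Set.Icc t₀ t₁) η t x + (Δ (η t)) x + convect (u t) (η t) x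
          + ContinuousLinearMap.adjoint (fderiv ℝ (u t) x) (η t x) = 0) →
      ContinuousOn (uncurry Λ) (Set.Icc t₀ t₁ ×ˢ univ) →
      (∃ B : ℝ, ∀ t ∈ Set.Icc t₀ t₁, ∀ x : EuclideanSpace ℝ (Fin 3), 0 ≤ Λ t x ∧ Λ t x ≤ B) →
      (∀ t ∈ Set.Icc t₀ t₁, ∀ (x ξ : EuclideanSpace ℝ (Fin 3)),
        ⟪fderiv ℝ (u t) x ξ, ξ⟫ ≤ Λ t x * ‖ξ‖ ^ 2) →
      ∀ s ∈ Set.Icc t₀ t₁,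
        ∫ x, ‖η s x‖ ≤ (∫ x, ‖η t₁ x‖) + ∫ t in s..t₁, ∫ x, Λ t x * ‖η t x‖ := by
  intro t₀ t₁ h01 u η Λ hu hdiv hbd hη hηd hpde hΛc hΛb hΛ s hs
  obtain ⟨B, hB⟩ := hbd
  obtain ⟨BΛ, hBΛ⟩ := hΛb
  -- decay, integrability and the uniform `L¹` bound
  obtain ⟨C₀, hC₀0, hC₀⟩ := hηd.norm_le_rpow 4
  have hC₀' : ∀ t ∈ Icc t₀ t₁, ∀ x : EuclideanSpace ℝ (Fin 3),
      ‖η t x‖ ≤ C₀ * (1 + ‖x‖) ^ (-(4 : ℝ)) := fun t ht x => by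
    exact_mod_cast hC₀ t ht x
  have hdim : (Module.finrank ℝ (EuclideanSpace ℝ (Fin 3)) : ℝ) < 4 := by
    rw [finrank_euclideanSpace_fin]; norm_num
  have hηc : ∀ t ∈ Icc t₀ t₁, Continuous (η t) := fun t ht => hη.continuous_slice ht
  have hηi : ∀ t ∈ Icc t₀ t₁, Integrable (η t) := fun t ht =>
    integrable_of_norm_le_rpow_neg (hηc t ht) hdim (hC₀' t ht)
  have hJ : Integrable (fun x : EuclideanSpace ℝ (Fin 3) => (1 + ‖x‖) ^ (-(4 : ℝ))) :=
    integrable_one_add_norm hdim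
  obtain ⟨M, hMdef⟩ : ∃ M : ℝ, M = ∫ x : EuclideanSpace ℝ (Fin 3), C₀ * (1 + ‖x‖) ^ (-(4 : ℝ)) :=
    ⟨_, rfl⟩
  have hM : ∀ t ∈ Icc t₀ t₁, ∫ x, ‖η t x‖ ≤ M := fun t ht =>
    hMdef ▸ integral_mono (hηi t ht).norm (hJ.const_mul C₀) (hC₀' t ht)
  -- the slices of `Λ` and the source `G(t) = ∫ Λ t ‖η t‖`
  have hΛsl : ∀ t ∈ Icc t₀ t₁, Continuous (Λ t) := fun t ht =>
    hΛc.comp_continuous (continuous_const.prodMk continuous_id) fun x => ⟨ht, mem_univ x⟩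
  have hΛi : ∀ t ∈ Icc t₀ t₁, Integrable fun x => Λ t x * ‖η t x‖ := fun t ht =>
    Integrable.mono' ((hηi t ht).norm.const_mul BΛ)
      ((hΛsl t ht).mul (hηc t ht).norm).aestronglyMeasurable (Eventually.of_forall fun x => by
      rw [Real.norm_eq_abs, abs_mul, abs_norm, abs_of_nonneg (hBΛ t ht x).1]
      exact mul_le_mul_of_nonneg_right (hBΛ t ht x).2 (norm_nonneg _))
  have hG : ContinuousOn (fun t => ∫ x, Λ t x * ‖η t x‖) (Icc t₀ t₁) := by
    refine continuousOn_of_dominated (bound := fun x => BΛ * (C₀ * (1 + ‖x‖) ^ (-(4 : ℝ))))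
      (fun t ht => ((hΛsl t ht).mul (hηc t ht).norm).aestronglyMeasurable)
      (fun t ht => Eventually.of_forall fun x => ?_) ((hJ.const_mul C₀).const_mul BΛ)
      (Eventually.of_forall fun x => ?_)
    · rw [Real.norm_eq_abs, abs_mul, abs_norm, abs_of_nonneg (hBΛ t ht x).1]
      exact mul_le_mul (hBΛ t ht x).2 (hC₀' t ht x) (norm_nonneg _)
        ((hBΛ t ht x).1.trans (hBΛ t ht x).2)
    · have h1 : ContinuousOn (fun t => Λ t x) (Icc t₀ t₁) :=
        hΛc.comp (continuousOn_id.prodMk continuousOn_const) fun t ht => ⟨ht, mem_univ x⟩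
      exact h1.mul (hη.continuousOn_time x).norm
  -- cut-off constants and the drift
  obtain ⟨C₁, hC₁0, hC₁⟩ := exists_norm_fderiv_cutoff_le (E := EuclideanSpace ℝ (Fin 3))
  obtain ⟨C₂, hC₂0, hC₂⟩ := exists_abs_laplacian_cutoff_le (E := EuclideanSpace ℝ (Fin 3))
  have hu1 : ∀ t ∈ Icc t₀ t₁, ContDiff ℝ 1 (u t) := fun t ht =>
    (hu.contDiff_slice ht).of_le (by exact_mod_cast le_top)
  have hB' : ∀ t ∈ Icc t₀ t₁, ∀ x, ‖u t x‖ ≤ B := fun t ht x => (hB t ht x).1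
  have hΛ0 : ∀ t ∈ Icc t₀ t₁, ∀ x, 0 ≤ Λ t x := fun t ht x => (hBΛ t ht x).1
  have ht₁ : t₁ ∈ Icc t₀ t₁ := right_mem_Icc.2 h01.le
  -- the inequality at level `n`: `δ = 1/(n+1)`, `R = n + 1`
  have key : ∀ n : ℕ,
      ∫ x, (absApprox (1 / ((n : ℝ) + 1)) ‖η s x‖ - 1 / ((n : ℝ) + 1)) * cutoff ((n : ℝ) + 1) x ≤
        (∫ x, (absApprox (1 / ((n : ℝ) + 1)) ‖η t₁ x‖ - 1 / ((n : ℝ) + 1)) *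
            cutoff ((n : ℝ) + 1) x) +
          (B * C₁ + C₂) / ((n : ℝ) + 1) * M * (t₁ - s) + ∫ t in s..t₁, ∫ x, Λ t x * ‖η t x‖ := by
    intro n
    have hn : (1 : ℝ) ≤ (n : ℝ) + 1 := by simp
    have hn0 : (0 : ℝ) < (n : ℝ) + 1 := by positivity
    exact clockMass_cutoffIntegral_le h01 hu1 hdiv hB' hη hpde hηi hM hΛ0 hΛ hΛi hG
      (by positivity) hn hC₁0 (hC₁ _ hn0) hC₂0 (hC₂ _ hn0) hs
  -- pass to the limit
  have hlim : ∀ t ∈ Icc t₀ t₁, Tendsto (fun n : ℕ => ∫ x, (absApprox (1 / ((n : ℝ) + 1)) ‖η t x‖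
      - 1 / ((n : ℝ) + 1)) * cutoff ((n : ℝ) + 1) x) atTop (𝓝 (∫ x, ‖η t x‖)) := fun t ht =>
    clockMass_tendsto_cutoffIntegral (hηc t ht) (hηi t ht)
  have hK : Tendsto (fun n : ℕ => (B * C₁ + C₂) / ((n : ℝ) + 1) * M * (t₁ - s)) atTop (𝓝 0) := by
    have h1 : Tendsto (fun n : ℕ => (B * C₁ + C₂) / ((n : ℝ) + 1)) atTop (𝓝 0) :=
      tendsto_const_nhds.div_atTop (tendsto_natCast_atTop_atTop.atTop_add tendsto_const_nhds)
    simpa using (h1.mul_const M).mul_const (t₁ - s)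
  have := le_of_tendsto_of_tendsto' (hlim s hs)
    (((hlim t₁ ht₁).add hK).add_const (∫ t in s..t₁, ∫ x, Λ t x * ‖η t x‖)) key
  simpa using this

end Summit.NavierStokesRegularity.NavierStokesRegularity.Theorems

end
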